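import Literature.Probability.Percolation.TwoClusterConditionalAssociationProofs
import Literature.Probability.Percolation.TwoClusterExchange
import Literature.Probability.Percolation.PercolationEvents
import Literature.Probability.LatticeModels.ProdBernoulliIndependence
import HarnessLib

/-!
# Cluster / off-cluster negative correlation given `{s ↮ X}`, the loner-attachment monotonicity,
# and lone-port sums — corollaries of van den Berg–Häggström–Kahn 2006, Thm. 1.3

Bond percolation with arbitrary edge probabilities on a
finite vertex type `V` (`μ = prodBernoulli w` on `BondConfig V = Set (Sym2 V)`); `C_s` the open edge
cluster of `s` (`openEdgeCluster`).  BHK's Theorem 1.3 [VandenbergHaggstromKahn2005, Thm. 1.3 p. 6;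
here the proved statement `BHK2006_clusterConditionalPositiveAssociation`] says that given
`D_X = {s ↮ X}` (a SET `X ∌ s`) the cluster `C_s` is positively associated.  BHK derive their
two-cluster Theorems 1.4/1.5 (for `X = {t}`) from it by conditioning on `C_s = W` ("display (10)",
pp. 7–8; here `BHK2006.sum_cond_cluster`).  Running the same printed argument with a separation SET
gives (this file, everything proved, no definition):

* `setSep_negCorrelation` — for `s ∉ X`, `t ∈ X`, `F` increasing (a function of `C_s`) and `G`
  increasing (a function of `C_t`):  `μ(D_X) · ∫_{D_X} F(C_s) G(C_t) ≤ (∫_{D_X} F(C_s)) (∫_{D_X} G(C_t))`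
  ("given `s ↮ X`, the cluster of `s` and increasing events of the cluster of a separated `t ∈ X` are
  negatively correlated"; `X = {t}` is BHK's Theorem 1.4);
* `lonerAttachment_glued_le_separate` — three ports `p₁, p₂, p₃` (`p₃ ∉ {p₁, p₂}`), a vertex `v`,
  `I = {p₃ ↮ p₁, p₃ ↮ p₂}`:  `μ(I) · μ(I ∩ {p₃↔v} ∩ {p₁↔p₂}) ≤ μ(I ∩ {p₃↔v}) · μ(I ∩ {p₁↔p₂})`,
  i.e. `P(v ↔ p₃ | p₁p₂ glued, p₃ alone) ≤ P(v ↔ p₃ | p₃ alone)`; equivalently (`I` being the disjoint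
  union of `12|3 = I ∩ {p₁↔p₂}` and `Sep = I ∩ {p₁↮p₂}`) the quadratic pattern inequality
  `lonerAttachment_glued_le_sep`:  `μ(Sep) · μ(12|3 ∩ {p₃↔v}) ≤ μ(Sep ∩ {p₃↔v}) · μ(12|3)`
  ("`x3 · S ≤ x13 · G12`": attaching to the lone port is LESS likely when the other two ports are glued
  than when all three are separate);
* `lonePortSum_three` — the three-term LONE-PORT SUM: with `σ_q = {q alone, the other two glued}`,
  `A = {p₁ ↔ p₂ ↔ p₃}`, all of positive probability,
  `Σ_q μ(σ_q ∩ {q↔v})/μ(σ_q) ≤ μ(A ∩ {p₁↔v})/μ(A)`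
  (each term is at most its all-separate version by the previous item; on `Sep` the three events
  `{q ↔ v}` are disjoint; Harris twice).  Its two-port analogue is Harris' inequality; the two-term
  sub-sums sharing a separation event are `lonePortAttachment_sum` (file `LonePortAttachment.lean`).

These are the interior inequalities behind the `m = 3` hull-port exchange used for `NoHeavyLowerTail`.

## References

* J. van den Berg, O. Häggström, J. Kahn, *Some conditional correlation inequalities for percolation and
  related processes*, Random Structures Algorithms 29 (2006) 417–435: Thm. 1.3 (p. 6), proof of
  Thm. 1.5 (pp. 7–8, display (10)). [VandenbergHaggstromKahn2005]
* G. Grimmett, *Percolation*, 2nd ed., Springer 1999, Thm. (2.4) p. 34 (Harris–FKG). [GrimmettPercolation1999]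
-/

noncomputable section

open MeasureTheory Set
open Literature.Probability.LatticeModels

namespace Literature.Probability.Percolation

variable {V : Type*}

namespace LonePortSum

open BHK2006 DecisionTree
open scoped Classical

/-- `∫_D h dμ` as a finite weighted sum. [folklore] -/
theorem setIntegral_eq_sum [Fintype V] (w : Sym2 V → unitInterval) (D : Set (BondConfig V))
    (h : BondConfig V → ℝ) :
    ∫ ω in D, h ω ∂(prodBernoulli w) =
      ∑ ω, weight (fun e => (w e : ℝ)) ω * (h ω * ind D ω) := by
  rw [← integral_indicator (MeasurableSet.of_discrete : MeasurableSet D),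
    integral_prodBernoulli_eq_sum]
  refine Finset.sum_congr rfl fun ω _ => ?_
  by_cases hω : ω ∈ D
  · rw [Set.indicator_of_mem hω, ind_of_mem hω, mul_one]
  · rw [Set.indicator_of_notMem hω, ind_of_not_mem hω]; ring

/-- `μ(D)` as a finite weighted sum. [folklore] -/
theorem measureReal_eq_sum [Fintype V] (w : Sym2 V → unitInterval) (D : Set (BondConfig V)) :
    (prodBernoulli w).real D = ∑ ω, weight (fun e => (w e : ℝ)) ω * ind D ω := by
  rw [← integral_indicator_one (MeasurableSet.of_discrete : MeasurableSet D),
    integral_prodBernoulli_eq_sum]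
  refine Finset.sum_congr rfl fun ω _ => ?_
  by_cases hω : ω ∈ D
  · rw [Set.indicator_of_mem hω, ind_of_mem hω, Pi.one_apply]
  · rw [Set.indicator_of_notMem hω, ind_of_not_mem hω, mul_zero]

end LonePortSum

open LonePortSum BHK2006 DecisionTree in
/-- **Cluster / off-cluster negative correlation given `{s ↮ X}`** (BHK 2006, Thm. 1.3 run through
the printed conditioning-on-`C_s` argument of their proof of Thm. 1.5, with a separation SET).  For
`s ∉ X`, `t ∈ X`, `F` monotone (applied to `C_s`) and `G` monotone (applied to `C_t`), with
`D_X = {s ↮ x ∀ x ∈ X}`: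
`μ(D_X) · ∫_{D_X} F(C_s) G(C_t) dμ ≤ (∫_{D_X} F(C_s) dμ) · (∫_{D_X} G(C_t) dμ)`.
Proof: on `{C_s = W} ∩ {s ↮ t}` the cluster `C_t` is that of the fresh configuration off `W̄`
(`BHK2006.sum_cond_cluster`), so `∫_{D_X} F(C_s) G(C_t) = ∫_{D_X} F(C_s) ψ(C_s)` with
`ψ(W) = E[G(C_t(η ∖ W̄))]` DEcreasing in `W` (`BHK2006.condAvg_mono`); conclude with Theorem 1.3 for
the pair (`F` increasing, `ψ` decreasing) given `{s ↮ X}`.  For `X = {t}` this is BHK's Theorem 1.4.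
[cite: VandenbergHaggstromKahn2005, Thm. 1.3 (p. 6) and pp. 7–8 — corollary, derived in this file] -/
theorem setSep_negCorrelation [Fintype V] (w : Sym2 V → unitInterval) (s t : V) (X : Set V)
    (hs : s ∉ X) (ht : t ∈ X) (F G : Set (Sym2 V) → ℝ) (hF : Monotone F) (hG : Monotone G) :
    (prodBernoulli w).real {ω : BondConfig V | ∀ x ∈ X, ¬ (openGraph ω).Reachable s x} *
      (∫ ω in {ω : BondConfig V | ∀ x ∈ X, ¬ (openGraph ω).Reachable s x},
        F (openEdgeCluster ω s) * G (openEdgeCluster ω t) ∂(prodBernoulli w)) ≤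
    (∫ ω in {ω : BondConfig V | ∀ x ∈ X, ¬ (openGraph ω).Reachable s x},
        F (openEdgeCluster ω s) ∂(prodBernoulli w)) *
      ∫ ω in {ω : BondConfig V | ∀ x ∈ X, ¬ (openGraph ω).Reachable s x},
        G (openEdgeCluster ω t) ∂(prodBernoulli w) := by
  classical
  set DX : Set (BondConfig V) := {ω | ∀ x ∈ X, ¬ (openGraph ω).Reachable s x} with hDX
  set Dt : Set (BondConfig V) := {ω | ¬ (openGraph ω).Reachable s t} with hDt
  have hDtmem : ∀ ω, ω ∈ Dt ↔ ¬ (openGraph ω).Reachable s t := fun ω => by rw [hDt]; rfl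
  set w' : Sym2 V → ℝ := fun e => (w e : ℝ) with hw'
  have hw0 : ∀ e, 0 ≤ w' e := fun e => (w e).2.1
  have hw1 : ∀ e, w' e ≤ 1 := fun e => (w e).2.2
  have hm : ∑ ω, weight w' ω = 1 := by
    have h1 := integral_prodBernoulli_eq_sum w fun _ => (1 : ℝ)
    simp only [integral_const, probReal_univ, smul_eq_mul, mul_one] at h1
    exact h1.symm
  -- the indicator that an edge set `C` (here `C = C_s`) avoids `X`
  set NX : Set (Sym2 V) → ℝ := fun C => if ∀ x ∈ X, ¬ (x = s ∨ ∃ e ∈ C, x ∈ e) then 1 else 0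
    with hNX
  -- `1_{D_X} = NX(C_s) · 1_{D_t}`
  have hind : ∀ ω : BondConfig V, ind DX ω = NX (openEdgeCluster ω s) * ind Dt ω := by
    intro ω
    by_cases hω : ω ∈ DX
    · have hω' : ∀ x ∈ X, ¬ (openGraph ω).Reachable s x := hω
      have h1 : ∀ x ∈ X, ¬ (x = s ∨ ∃ e ∈ openEdgeCluster ω s, x ∈ e) := fun x hx h =>
        hω' x hx ((reachable_iff_exists_mem_openEdgeCluster ω s x).2 h)
      have h2 : ω ∈ Dt := (hDtmem ω).2 (hω' t ht)
      rw [ind_of_mem hω, ind_of_mem h2, hNX]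
      simp only [if_pos h1, mul_one]
    · have hω' : ∃ x ∈ X, (openGraph ω).Reachable s x := by
        by_contra hcon
        exact hω fun x hx hr => hcon ⟨x, hx, hr⟩
      obtain ⟨x, hx, hr⟩ := hω'
      have h1 : ¬ ∀ x ∈ X, ¬ (x = s ∨ ∃ e ∈ openEdgeCluster ω s, x ∈ e) := fun h =>
        h x hx ((reachable_iff_exists_mem_openEdgeCluster ω s x).1 hr)
      rw [ind_of_not_mem hω, hNX]
      simp only [if_neg h1, zero_mul]
  -- `ψ(W) = E[G(C_t)]` in the fresh variables off `W̄`; it is decreasing in `W`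
  set ψ : Set (Sym2 V) → ℝ := fun W => ∑ η, weight w' η *
      G (openEdgeCluster (η \ {e | ∃ v ∈ e, v = s ∨ ∃ e' ∈ W, v ∈ e'}) t) with hψ
  have hψanti : Antitone ψ := by
    have hmono : Monotone fun W => ∑ η, weight w' η *
        (fun (_ : Set (Sym2 V)) (C : Set (Sym2 V)) => -G C) W
          (openEdgeCluster (η \ {e | ∃ v ∈ e, v = s ∨ ∃ e' ∈ W, v ∈ e'}) t) :=
      condAvg_mono hw0 hw1 t (bar_mono s) (H := fun _ C => -G C) (fun _ => monotone_const)
        (fun _ _ _ hDD' => neg_le_neg (hG hDD'))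
    intro W W' hWW'
    have h := hmono hWW'
    simp only [mul_neg, Finset.sum_neg_distrib, neg_le_neg_iff] at h
    exact h
  -- display (10) for `H = F · NX · G` and for `H = NX · G`
  have e1 := sum_cond_cluster w' hm s t (fun C C' => F C * NX C * G C') hDtmem
  have e2 := sum_cond_cluster w' hm s t (fun C C' => NX C * G C') hDtmem
  -- rewrite the three integrals and `μ(D_X)` of the goal as sums over `D_t` with the factor `NX`
  have hint := setIntegral_eq_sum w DX
  have i1 : ∫ ω in DX, F (openEdgeCluster ω s) * G (openEdgeCluster ω t) ∂(prodBernoulli w) =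
      ∑ ω, weight w' ω * (F (openEdgeCluster ω s) * ψ (openEdgeCluster ω s) * ind DX ω) := by
    rw [hint]
    have lhs : ∑ ω, weight w' ω * (F (openEdgeCluster ω s) * G (openEdgeCluster ω t) * ind DX ω) =
        ∑ ω, weight w' ω * ((fun C C' => F C * NX C * G C') (openEdgeCluster ω s)
          (openEdgeCluster ω t) * ind Dt ω) :=
      Finset.sum_congr rfl fun ω _ => by rw [hind ω]; ring
    rw [lhs, e1]
    refine Finset.sum_congr rfl fun ω _ => ?_
    rw [hind ω, hψ]
    simp only
    rw [show (∑ η, weight w' η * (F (openEdgeCluster ω s) * NX (openEdgeCluster ω s) *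
        G (openEdgeCluster (η \ {e | ∃ v ∈ e, v = s ∨ ∃ e' ∈ openEdgeCluster ω s, v ∈ e'}) t))) =
        F (openEdgeCluster ω s) * NX (openEdgeCluster ω s) * ∑ η, weight w' η *
          G (openEdgeCluster (η \ {e | ∃ v ∈ e, v = s ∨ ∃ e' ∈ openEdgeCluster ω s, v ∈ e'}) t) by
      rw [Finset.mul_sum]; refine Finset.sum_congr rfl fun η _ => ?_; ring]
    ring
  have i2 : ∫ ω in DX, G (openEdgeCluster ω t) ∂(prodBernoulli w) =
      ∑ ω, weight w' ω * (ψ (openEdgeCluster ω s) * ind DX ω) := by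
    rw [hint]
    have lhs : ∑ ω, weight w' ω * (G (openEdgeCluster ω t) * ind DX ω) =
        ∑ ω, weight w' ω * ((fun C C' => NX C * G C') (openEdgeCluster ω s)
          (openEdgeCluster ω t) * ind Dt ω) :=
      Finset.sum_congr rfl fun ω _ => by rw [hind ω]; ring
    rw [lhs, e2]
    refine Finset.sum_congr rfl fun ω _ => ?_
    rw [hind ω, hψ]
    simp only
    rw [show (∑ η, weight w' η * (NX (openEdgeCluster ω s) *
        G (openEdgeCluster (η \ {e | ∃ v ∈ e, v = s ∨ ∃ e' ∈ openEdgeCluster ω s, v ∈ e'}) t))) =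
        NX (openEdgeCluster ω s) * ∑ η, weight w' η *
          G (openEdgeCluster (η \ {e | ∃ v ∈ e, v = s ∨ ∃ e' ∈ openEdgeCluster ω s, v ∈ e'}) t) by
      rw [Finset.mul_sum]; refine Finset.sum_congr rfl fun η _ => ?_; ring]
    ring
  have i1' : ∫ ω in DX, F (openEdgeCluster ω s) * ψ (openEdgeCluster ω s) ∂(prodBernoulli w) =
      ∑ ω, weight w' ω * (F (openEdgeCluster ω s) * ψ (openEdgeCluster ω s) * ind DX ω) := hint _
  have i2' : ∫ ω in DX, ψ (openEdgeCluster ω s) ∂(prodBernoulli w) =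
      ∑ ω, weight w' ω * (ψ (openEdgeCluster ω s) * ind DX ω) := hint _
  -- Theorem 1.3 (increasing `F`, decreasing `ψ`) given `{s ↮ X}`
  have h13 := BHK2006_clusterConditionalPositiveAssociation_holds.antitone_right V w s X F ψ hF
    hψanti hs
  rw [i1', i2'] at h13
  rw [i1, i2]
  exact h13

open LonePortSum in
/-- **Loner-attachment monotonicity** (event form of `setSep_negCorrelation`).  For ports
`p₁, p₂, p₃` with `p₃ ≠ p₁`, `p₃ ≠ p₂`, a vertex `v`, and `I = {p₃ ↮ p₁} ∩ {p₃ ↮ p₂}`: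
`μ(I) · μ(I ∩ {p₃↔v} ∩ {p₁↔p₂}) ≤ μ(I ∩ {p₃↔v}) · μ(I ∩ {p₁↔p₂})`, i.e.
`P(v ↔ p₃ | p₁p₂ glued, p₃ alone) ≤ P(v ↔ p₃ | p₃ alone)`.
[cite: VandenbergHaggstromKahn2005, Thm. 1.3 (p. 6) — corollary, derived in this file] -/
theorem lonerAttachment_glued_le_separate [Fintype V] (w : Sym2 V → unitInterval) (v p₁ p₂ p₃ : V)
    (h31 : p₃ ≠ p₁) (h32 : p₃ ≠ p₂) :
    (prodBernoulli w).real {ω : BondConfig V | ∀ x ∈ ({p₁, p₂} : Set V), ¬ (openGraph ω).Reachable p₃ x} *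
      (prodBernoulli w).real ({ω : BondConfig V | ∀ x ∈ ({p₁, p₂} : Set V), ¬ (openGraph ω).Reachable p₃ x}
        ∩ (openConn p₃ v ∩ openConn p₁ p₂)) ≤
    (prodBernoulli w).real ({ω : BondConfig V | ∀ x ∈ ({p₁, p₂} : Set V), ¬ (openGraph ω).Reachable p₃ x}
        ∩ openConn p₃ v) *
      (prodBernoulli w).real ({ω : BondConfig V | ∀ x ∈ ({p₁, p₂} : Set V), ¬ (openGraph ω).Reachable p₃ x}
        ∩ openConn p₁ p₂) := by
  have hs : p₃ ∉ ({p₁, p₂} : Set V) := by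
    simp only [Set.mem_insert_iff, Set.mem_singleton_iff, not_or]; exact ⟨h31, h32⟩
  have ht : p₁ ∈ ({p₁, p₂} : Set V) := Set.mem_insert p₁ {p₂}
  have key := setSep_negCorrelation w p₃ p₁ {p₁, p₂} hs ht (connIndicatorFn p₃ v)
    (connIndicatorFn p₁ p₂) (monotone_connIndicatorFn p₃ v) (monotone_connIndicatorFn p₁ p₂)
  have hFG : (fun ω : BondConfig V => connIndicatorFn p₃ v (openEdgeCluster ω p₃) *
      connIndicatorFn p₁ p₂ (openEdgeCluster ω p₁)) =
      fun ω => (openConn p₃ v).indicator (1 : BondConfig V → ℝ) ω *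
        (openConn p₁ p₂).indicator (1 : BondConfig V → ℝ) ω := by
    funext ω; rw [connIndicatorFn_openEdgeCluster, connIndicatorFn_openEdgeCluster]
  have hF : (fun ω : BondConfig V => connIndicatorFn p₃ v (openEdgeCluster ω p₃)) =
      fun ω => (openConn p₃ v).indicator (1 : BondConfig V → ℝ) ω := by
    funext ω; rw [connIndicatorFn_openEdgeCluster]
  have hG : (fun ω : BondConfig V => connIndicatorFn p₁ p₂ (openEdgeCluster ω p₁)) =
      fun ω => (openConn p₁ p₂).indicator (1 : BondConfig V → ℝ) ω := by
    funext ω; rw [connIndicatorFn_openEdgeCluster]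
  rw [hFG, hF, hG, TripodExchange.setIntegral_indicator_mul_indicator_eq,
    TripodExchange.setIntegral_indicator_one_eq, TripodExchange.setIntegral_indicator_one_eq] at key
  exact key

namespace LonePortSum

/-- Symmetry of `{x ↔ y}` as a membership statement. [folklore] -/
theorem mem_openConn_symm {x y : V} {ω : BondConfig V} (h : ω ∈ openConn x y) : ω ∈ openConn y x :=
  SimpleGraph.Reachable.symm h

/-- Transitivity of `↔` as a membership statement. [folklore] -/
theorem mem_openConn_trans {x y z : V} {ω : BondConfig V} (h₁ : ω ∈ openConn x y)
    (h₂ : ω ∈ openConn y z) : ω ∈ openConn x z :=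
  SimpleGraph.Reachable.trans h₁ h₂

end LonePortSum

open LonePortSum in
/-- **Loner attachment: glued pair versus all separate (quadratic pattern inequality).**  For ports
`p₁, p₂, p₃` (`p₃ ≠ p₁, p₂`) and a vertex `v`, with `Sep = {p₁↮p₂} ∩ {p₁↮p₃} ∩ {p₂↮p₃}` and
`12|3 = {p₁↔p₂} ∩ {p₁↮p₃}`:  `μ(Sep) · μ(12|3 ∩ {p₃↔v}) ≤ μ(Sep ∩ {p₃↔v}) · μ(12|3)` — in the
pattern coordinates of the hull-port line, `x3 · S ≤ x13 · G12`: `P(v ↔ p₃ | 12|3) ≤ P(v ↔ p₃ | Sep)`.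
(From `lonerAttachment_glued_le_separate`: `{p₃ alone}` is the disjoint union of `12|3` and `Sep`.)
[cite: VandenbergHaggstromKahn2005, Thm. 1.3 (p. 6) — corollary, derived in this file] -/
theorem lonerAttachment_glued_le_sep [Fintype V] (w : Sym2 V → unitInterval) (v p₁ p₂ p₃ : V)
    (h31 : p₃ ≠ p₁) (h32 : p₃ ≠ p₂) :
    (prodBernoulli w).real ((openConn p₁ p₂)ᶜ ∩ ((openConn p₁ p₃)ᶜ ∩ (openConn p₂ p₃)ᶜ) : Set (BondConfig V)) *
      (prodBernoulli w).real (openConn p₁ p₂ ∩ (openConn p₁ p₃)ᶜ ∩ openConn p₃ v : Set (BondConfig V)) ≤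
    (prodBernoulli w).real ((openConn p₁ p₂)ᶜ ∩ ((openConn p₁ p₃)ᶜ ∩ (openConn p₂ p₃)ᶜ) ∩ openConn p₃ v
        : Set (BondConfig V)) *
      (prodBernoulli w).real (openConn p₁ p₂ ∩ (openConn p₁ p₃)ᶜ : Set (BondConfig V)) := by
  set μ := prodBernoulli w with hμ
  set I : Set (BondConfig V) := {ω | ∀ x ∈ ({p₁, p₂} : Set V), ¬ (openGraph ω).Reachable p₃ x} with hI
  set E : Set (BondConfig V) := openConn p₁ p₂ with hE
  set W : Set (BondConfig V) := openConn p₃ v with hW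
  set Sep : Set (BondConfig V) := (openConn p₁ p₂)ᶜ ∩ ((openConn p₁ p₃)ᶜ ∩ (openConn p₂ p₃)ᶜ) with hSep
  set B : Set (BondConfig V) := openConn p₁ p₂ ∩ (openConn p₁ p₃)ᶜ with hB
  have key := lonerAttachment_glued_le_separate w v p₁ p₂ p₃ h31 h32
  -- membership in `I`
  have hImem : ∀ ω : BondConfig V, ω ∈ I ↔ ω ∉ openConn p₃ p₁ ∧ ω ∉ openConn p₃ p₂ := by
    intro ω
    simp only [hI, Set.mem_setOf_eq, Set.mem_insert_iff, Set.mem_singleton_iff, forall_eq_or_imp,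
      forall_eq]
    rfl
  -- the four set identities
  have s1 : I ∩ E = B := by
    ext ω
    simp only [Set.mem_inter_iff, hImem, hB, hE, Set.mem_compl_iff]
    constructor
    · rintro ⟨⟨h1, _⟩, h12⟩
      exact ⟨h12, fun h13 => h1 (mem_openConn_symm h13)⟩
    · rintro ⟨h12, h13⟩
      exact ⟨⟨fun h => h13 (mem_openConn_symm h), fun h => h13 (mem_openConn_trans h12
        (mem_openConn_symm h))⟩, h12⟩
  have s2 : I \ E = Sep := by
    ext ω
    simp only [Set.mem_sdiff, hImem, hSep, hE, Set.mem_inter_iff, Set.mem_compl_iff]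
    constructor
    · rintro ⟨⟨h1, h2⟩, h12⟩
      exact ⟨h12, fun h => h1 (mem_openConn_symm h), fun h => h2 (mem_openConn_symm h)⟩
    · rintro ⟨h12, h13, h23⟩
      exact ⟨⟨fun h => h13 (mem_openConn_symm h), fun h => h23 (mem_openConn_symm h)⟩, h12⟩
  have s3 : I ∩ (W ∩ E) = (I ∩ W) ∩ E := by rw [Set.inter_assoc]
  have hmI : μ.real I = μ.real B + μ.real Sep := by
    rw [← s1, ← s2]; exact (measureReal_inter_add_sdiff MeasurableSet.of_discrete).symm
  have hmIW : μ.real (I ∩ W) = μ.real (B ∩ W) + μ.real (Sep ∩ W) := by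
    have h := (measureReal_inter_add_sdiff (μ := μ) (s := I ∩ W) (t := E) MeasurableSet.of_discrete).symm
    rw [show (I ∩ W) ∩ E = B ∩ W by rw [Set.inter_right_comm, s1],
      show (I ∩ W) \ E = Sep ∩ W by rw [Set.sdiff_eq, Set.inter_right_comm, ← Set.sdiff_eq, s2]] at h
    exact h
  have hx : μ.real (I ∩ (W ∩ E)) = μ.real (B ∩ W) := by
    rw [s3, Set.inter_right_comm, s1]
  rw [hx, s1, hmI, hmIW] at key
  -- `(b + S) x ≤ (x + y) b` gives `S x ≤ y b`
  have hgoal : μ.real Sep * μ.real (B ∩ W) ≤ μ.real (Sep ∩ W) * μ.real B := by nlinarith [key]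
  rw [show (openConn p₁ p₂ ∩ (openConn p₁ p₃)ᶜ ∩ openConn p₃ v : Set (BondConfig V)) = B ∩ W by rfl]
  exact hgoal

open LonePortSum in
/-- **The lone-port sum (three ports).**  For distinct ports `p₁, p₂, p₃`, a vertex `v`, the events
`23|1 = {p₂↔p₃} ∩ {p₁↮p₂}`, `13|2 = {p₁↔p₃} ∩ {p₁↮p₂}`, `12|3 = {p₁↔p₂} ∩ {p₁↮p₃}` ("`q` alone,
the other two glued"), `Sep` (all separate) and `A = {p₁↔p₂} ∩ {p₁↔p₃}` (all glued), all of positive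
probability:
`P(v↔p₁ | 23|1) + P(v↔p₂ | 13|2) + P(v↔p₃ | 12|3) ≤ P(v↔p₁ | A)`.
Proof: each term is at most `P(v↔q | Sep)` (`lonerAttachment_glued_le_sep`); on `Sep` the events
`{v↔q}` are disjoint, so the sum is `P(v ↔ {p₁,p₂,p₃} | Sep) ≤ P(v ↔ {p₁,p₂,p₃}) ≤ P(v ↔ p₁ | A)`
(Harris twice).  The two-port analogue is Harris' inequality.  Not in print; derived here.
[cite: VandenbergHaggstromKahn2005, Thm. 1.3 (p. 6) — corollary, derived in this file] -/
theorem lonePortSum_three [Fintype V] (w : Sym2 V → unitInterval) (v p₁ p₂ p₃ : V)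
    (h12 : p₁ ≠ p₂) (h13 : p₁ ≠ p₃) (h23 : p₂ ≠ p₃)
    (hS : 0 < (prodBernoulli w).real
      ((openConn p₁ p₂)ᶜ ∩ ((openConn p₁ p₃)ᶜ ∩ (openConn p₂ p₃)ᶜ) : Set (BondConfig V)))
    (hσ₁ : 0 < (prodBernoulli w).real (openConn p₂ p₃ ∩ (openConn p₁ p₂)ᶜ : Set (BondConfig V)))
    (hσ₂ : 0 < (prodBernoulli w).real (openConn p₁ p₃ ∩ (openConn p₁ p₂)ᶜ : Set (BondConfig V)))
    (hσ₃ : 0 < (prodBernoulli w).real (openConn p₁ p₂ ∩ (openConn p₁ p₃)ᶜ : Set (BondConfig V)))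
    (hA : 0 < (prodBernoulli w).real (openConn p₁ p₂ ∩ openConn p₁ p₃ : Set (BondConfig V))) :
    (prodBernoulli w).real (openConn p₂ p₃ ∩ (openConn p₁ p₂)ᶜ ∩ openConn p₁ v : Set (BondConfig V)) /
        (prodBernoulli w).real (openConn p₂ p₃ ∩ (openConn p₁ p₂)ᶜ : Set (BondConfig V)) +
      (prodBernoulli w).real (openConn p₁ p₃ ∩ (openConn p₁ p₂)ᶜ ∩ openConn p₂ v : Set (BondConfig V)) /
        (prodBernoulli w).real (openConn p₁ p₃ ∩ (openConn p₁ p₂)ᶜ : Set (BondConfig V)) +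
      (prodBernoulli w).real (openConn p₁ p₂ ∩ (openConn p₁ p₃)ᶜ ∩ openConn p₃ v : Set (BondConfig V)) /
        (prodBernoulli w).real (openConn p₁ p₂ ∩ (openConn p₁ p₃)ᶜ : Set (BondConfig V)) ≤
    (prodBernoulli w).real (openConn p₁ p₂ ∩ openConn p₁ p₃ ∩ openConn p₁ v : Set (BondConfig V)) /
      (prodBernoulli w).real (openConn p₁ p₂ ∩ openConn p₁ p₃ : Set (BondConfig V)) := by
  set μ := prodBernoulli w with hμ
  set Sep : Set (BondConfig V) := (openConn p₁ p₂)ᶜ ∩ ((openConn p₁ p₃)ᶜ ∩ (openConn p₂ p₃)ᶜ) with hSep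
  set V₁ : Set (BondConfig V) := openConn p₁ v
  set V₂ : Set (BondConfig V) := openConn p₂ v
  set V₃ : Set (BondConfig V) := openConn p₃ v
  set σ₁ : Set (BondConfig V) := openConn p₂ p₃ ∩ (openConn p₁ p₂)ᶜ
  set σ₂ : Set (BondConfig V) := openConn p₁ p₃ ∩ (openConn p₁ p₂)ᶜ
  set σ₃ : Set (BondConfig V) := openConn p₁ p₂ ∩ (openConn p₁ p₃)ᶜ
  set A : Set (BondConfig V) := openConn p₁ p₂ ∩ openConn p₁ p₃
  -- symmetry of `openConn` as set equalities
  have hsymm : ∀ x y : V, (openConn x y : Set (BondConfig V)) = openConn y x := fun x y =>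
    Set.ext fun _ => ⟨mem_openConn_symm, mem_openConn_symm⟩
  -- the three loner inequalities, with their `Sep` rewritten to the canonical one
  have c₃ : μ.real Sep * μ.real (σ₃ ∩ V₃) ≤ μ.real (Sep ∩ V₃) * μ.real σ₃ :=
    lonerAttachment_glued_le_sep w v p₁ p₂ p₃ h13.symm h23.symm
  have c₂ : μ.real Sep * μ.real (σ₂ ∩ V₂) ≤ μ.real (Sep ∩ V₂) * μ.real σ₂ := by
    have h := lonerAttachment_glued_le_sep w v p₁ p₃ p₂ h12.symm h23
    have hS' : ((openConn p₁ p₃)ᶜ ∩ ((openConn p₁ p₂)ᶜ ∩ (openConn p₃ p₂)ᶜ) : Set (BondConfig V)) = Sep := by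
      rw [hsymm p₃ p₂, hSep, ← Set.inter_assoc, ← Set.inter_assoc, Set.inter_comm (openConn p₁ p₃)ᶜ]
    rw [hS'] at h
    exact h
  have c₁ : μ.real Sep * μ.real (σ₁ ∩ V₁) ≤ μ.real (Sep ∩ V₁) * μ.real σ₁ := by
    have h := lonerAttachment_glued_le_sep w v p₂ p₃ p₁ h12 h13
    have hS' : ((openConn p₂ p₃)ᶜ ∩ ((openConn p₂ p₁)ᶜ ∩ (openConn p₃ p₁)ᶜ) : Set (BondConfig V)) = Sep := by
      rw [hsymm p₂ p₁, hsymm p₃ p₁, hSep, Set.inter_comm (openConn p₂ p₃)ᶜ, Set.inter_assoc]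
    have hσ' : (openConn p₂ p₃ ∩ (openConn p₂ p₁)ᶜ : Set (BondConfig V)) = σ₁ := by rw [hsymm p₂ p₁]
    rw [hS', hσ'] at h
    exact h
  -- each conditional probability is at most its `Sep` version
  have r₁ : μ.real (σ₁ ∩ V₁) / μ.real σ₁ ≤ μ.real (Sep ∩ V₁) / μ.real Sep := by
    rw [div_le_div_iff₀ hσ₁ hS]; linarith [c₁]
  have r₂ : μ.real (σ₂ ∩ V₂) / μ.real σ₂ ≤ μ.real (Sep ∩ V₂) / μ.real Sep := by
    rw [div_le_div_iff₀ hσ₂ hS]; linarith [c₂]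
  have r₃ : μ.real (σ₃ ∩ V₃) / μ.real σ₃ ≤ μ.real (Sep ∩ V₃) / μ.real Sep := by
    rw [div_le_div_iff₀ hσ₃ hS]; linarith [c₃]
  -- on `Sep` the three attachment events are disjoint: the sum is `μ(Sep ∩ U)`, `U = V₁ ∪ V₂ ∪ V₃`
  have d12 : Disjoint (Sep ∩ V₁) (Sep ∩ V₂) := by
    rw [Set.disjoint_left]
    rintro ω ⟨⟨hn12, -, -⟩, h1⟩ ⟨-, h2⟩
    exact hn12 (mem_openConn_trans h1 (mem_openConn_symm h2))
  have d13 : Disjoint (Sep ∩ V₁) (Sep ∩ V₃) := by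
    rw [Set.disjoint_left]
    rintro ω ⟨⟨-, hn13, -⟩, h1⟩ ⟨-, h3⟩
    exact hn13 (mem_openConn_trans h1 (mem_openConn_symm h3))
  have d23 : Disjoint (Sep ∩ V₂) (Sep ∩ V₃) := by
    rw [Set.disjoint_left]
    rintro ω ⟨⟨-, -, hn23⟩, h2⟩ ⟨-, h3⟩
    exact hn23 (mem_openConn_trans h2 (mem_openConn_symm h3))
  have hU : μ.real (Sep ∩ V₁) + μ.real (Sep ∩ V₂) + μ.real (Sep ∩ V₃) =
      μ.real (Sep ∩ (V₁ ∪ V₂ ∪ V₃)) := by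
    rw [Set.inter_union_distrib_left, Set.inter_union_distrib_left,
      measureReal_union (Disjoint.union_left d13 d23) MeasurableSet.of_discrete,
      measureReal_union d12 MeasurableSet.of_discrete]
  -- Harris: `μ(Sep ∩ U) ≤ μ(Sep) μ(U)` and `μ(U) μ(A) ≤ μ(U ∩ A)`
  have hUup : IsUpperSet (V₁ ∪ V₂ ∪ V₃) :=
    ((isUpperSet_openConn p₁ v).union (isUpperSet_openConn p₂ v)).union (isUpperSet_openConn p₃ v)
  have hSepLow : IsLowerSet Sep :=
    (isUpperSet_openConn p₁ p₂).compl.inter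
      ((isUpperSet_openConn p₁ p₃).compl.inter (isUpperSet_openConn p₂ p₃).compl)
  have hAup : IsUpperSet A := (isUpperSet_openConn p₁ p₂).inter (isUpperSet_openConn p₁ p₃)
  have hH1 : μ.real (Sep ∩ (V₁ ∪ V₂ ∪ V₃)) ≤ μ.real Sep * μ.real (V₁ ∪ V₂ ∪ V₃) := by
    have h := prodBernoulli_harris_upper_lower w hUup hSepLow MeasurableSet.of_discrete
      MeasurableSet.of_discrete
    rw [Set.inter_comm] at h
    rw [mul_comm]; exact h
  have hH2 : μ.real (V₁ ∪ V₂ ∪ V₃) * μ.real A ≤ μ.real ((V₁ ∪ V₂ ∪ V₃) ∩ A) :=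
    prodBernoulli_harris w hUup hAup MeasurableSet.of_discrete MeasurableSet.of_discrete
  -- `U ∩ A = A ∩ V₁`
  have hUA : (V₁ ∪ V₂ ∪ V₃) ∩ A = A ∩ V₁ := by
    ext ω
    simp only [Set.mem_inter_iff, Set.mem_union]
    constructor
    · rintro ⟨h | h3, hA12, hA13⟩
      · rcases h with h1 | h2
        · exact ⟨⟨hA12, hA13⟩, h1⟩
        · exact ⟨⟨hA12, hA13⟩, mem_openConn_trans hA12 h2⟩
      · exact ⟨⟨hA12, hA13⟩, mem_openConn_trans hA13 h3⟩
    · rintro ⟨⟨hA12, hA13⟩, h1⟩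
      exact ⟨Or.inl (Or.inl h1), hA12, hA13⟩
  rw [hUA] at hH2
  -- assemble
  have hsum : μ.real (Sep ∩ V₁) / μ.real Sep + μ.real (Sep ∩ V₂) / μ.real Sep +
      μ.real (Sep ∩ V₃) / μ.real Sep ≤ μ.real (V₁ ∪ V₂ ∪ V₃) := by
    rw [← add_div, ← add_div, hU, div_le_iff₀ hS, mul_comm]
    exact hH1
  have hlast : μ.real (V₁ ∪ V₂ ∪ V₃) ≤ μ.real (A ∩ V₁) / μ.real A := by
    rw [le_div_iff₀ hA]; exact hH2
  have hgoal : μ.real (σ₁ ∩ V₁) / μ.real σ₁ + μ.real (σ₂ ∩ V₂) / μ.real σ₂ +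
      μ.real (σ₃ ∩ V₃) / μ.real σ₃ ≤ μ.real (A ∩ V₁) / μ.real A := by linarith
  exact hgoal

end Literature.Probability.Percolation

end
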